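import Literature.NumberTheory.ModularForms.ModularCurveComplexStructure
import HarnessLib

/-!
# The local system of a parabolic-null character `u : Γ → ℝ` on `X(Γ)`: local primitives
# (Shimura §8.1–8.2, parabolic cohomology; Diamond–Shurman §2.4)

Layer `Literature/NumberTheory/ModularForms`, namespace `Literature.NumberTheory.ModularForms.ModularCurve`;
sequel of `ModularCurveComplexStructure`. G. Shimura, *Introduction to the arithmetic theory of automorphic
functions* (1971), §8.1 (8.1.1)–(8.1.4) and §8.2 p. 233: an additive `u : Γ → ℝ` that vanishes on the parabolic
elements of `Γ` («parabolic cocycle», `H¹_P(Γ, ℝ)`) is the period character of a closed `1`-form of the COMPACT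
surface `Γ∖ℍ*` — the cusp condition is what lets the form extend across the cusps. This file builds the
sheaf-theoretic version of that closed form, with NO analysis: its LOCAL PRIMITIVES.

Fix a finite-index `Γ ≤ SL₂(ℤ)` acting freely on `ℍ` and an additive parabolic-null `u`. A set-theoretic
`u`-EQUIVARIANT function `hfun u : ℍ → ℝ` (`hfun u (γz) = hfun u z + u γ`; built from a choice of orbit
representatives, no continuity needed) plays the role of the many-valued primitive `∫η_u` on `ℍ`, and a
**`u`-primitive on an open `W ⊆ X(Γ)`** (`IsUPrim u G W`) is a function `G : X(Γ) → ℝ` such that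
`G ∘ (inl ∘ π) − hfun u` is locally constant over `W`, and which near each cusp `cuspPt i ∈ W` is
`hfun u ∘ σ_i + G(cuspPt i)` on a horoball (possible exactly because `u` kills the cusp stabiliser).

* `hfun`, `hfun_smul`; `IsUPrim`, `.mono`, `.add_const`, `.sub_eventuallyEq` (two primitives on an open set differ
  by a LOCALLY CONSTANT function — also across the cusps);
* `u_eq_zero_of_smul_frameGL_eq` (elements of `Γ` identifying two points of one cusp sector are parabolic or
  trivial, so `u` kills them); `cuspSection`, `isUPrim_cuspSection` (the primitive on a whole cusp disc);
* ★ `exists_isUPrim_extend` — the LOCAL EXTENSION property in the shape consumed by the tree's monodromy theorem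
  `Literature.Topology.CoveringSpaces.exists_extension_of_simplyConnected`: every point of `X(Γ)` has a preconnected
  open neighbourhood `W` over which every germ of a `u`-primitive extends (interior: a slice of `π`; cusp: the
  cusp disc); `exists_isUPrim_nhds`.

Everything is proved; definitions: `hfun`, `IsUPrim`, `cuspSection`.

## References

* G. Shimura, *Introduction to the arithmetic theory of automorphic functions* (1971), §8.1 (8.1.1)–(8.1.4), §8.2
  pp. 230–234. [ShimuraIATAF1971]
* F. Diamond, J. Shurman, *A first course in modular forms*, GTM 228 (2005), §2.4. [DiamondShurman2005]
-/

noncomputable section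

open scoped MatrixGroups Pointwise Topology
open Set Filter Function UpperHalfPlane

namespace Literature.NumberTheory.ModularForms

namespace ModularCurve

variable (Γ : Subgroup SL(2, ℤ)) [Γ.FiniteIndex] [IsCancelSMul (Γ : Subgroup (GL (Fin 2) ℝ)) ℍ]

/-! ### A `u`-equivariant function on `ℍ` -/

omit [Γ.FiniteIndex] in
/-- The deck element of a point: the unique `γ ∈ Γ` carrying `z` to the chosen representative of its orbit
(free action). [cite: ShimuraIATAF1971, §1.5] -/
theorem exists_unique_smul_eq_out (z : ℍ) :
    ∃! γ : (Γ : Subgroup (GL (Fin 2) ℝ)), γ • z = Quotient.out (proj Γ z) := by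
  have h : proj Γ (Quotient.out (proj Γ z)) = proj Γ z := Quotient.out_eq _
  obtain ⟨γ, hγ, e⟩ := (proj_eq_iff Γ).1 h
  refine ⟨⟨γ, hγ⟩, e, fun δ hδ => ?_⟩
  have : (δ : GL (Fin 2) ℝ) • z = (⟨γ, hγ⟩ : (Γ : Subgroup (GL (Fin 2) ℝ))) • z := by rw [← e] at hδ; exact hδ
  exact IsCancelSMul.right_cancel _ _ _ this

omit [Γ.FiniteIndex] in
/-- The deck element `γ_z` with `γ_z • z = out(π z)`. [cite: ShimuraIATAF1971, §1.5] -/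
def deckOf (z : ℍ) : (Γ : Subgroup (GL (Fin 2) ℝ)) := (exists_unique_smul_eq_out Γ z).choose

omit [Γ.FiniteIndex] in
/-- The defining property of `deckOf`. [cite: ShimuraIATAF1971, §1.5] -/
theorem deckOf_smul (z : ℍ) : deckOf Γ z • z = Quotient.out (proj Γ z) := (exists_unique_smul_eq_out Γ z).choose_spec.1

omit [Γ.FiniteIndex] in
/-- `γ_{δz} = γ_z δ⁻¹`. [cite: ShimuraIATAF1971, §1.5] -/
theorem deckOf_smul_eq (δ : (Γ : Subgroup (GL (Fin 2) ℝ))) (z : ℍ) : deckOf Γ (δ • z) = deckOf Γ z * δ⁻¹ := by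
  have h1 := deckOf_smul Γ (δ • z)
  have hproj : proj Γ ((δ : GL (Fin 2) ℝ) • z) = proj Γ z := proj_smul Γ δ.2 z
  have h2 : (deckOf Γ z * δ⁻¹) • (δ • z) = Quotient.out (proj Γ (δ • z)) := by
    rw [mul_smul, inv_smul_smul, deckOf_smul]
    show Quotient.out (proj Γ z) = Quotient.out (proj Γ ((δ : GL (Fin 2) ℝ) • z))
    rw [hproj]
  exact (exists_unique_smul_eq_out Γ (δ • z)).unique h1 h2

variable {Γ}

/-- **The `u`-equivariant function** `hfun u z = −u(γ_z)`: `hfun u (δz) = hfun u z + u δ` for additive `u`.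
[cite: ShimuraIATAF1971, §8.2 (8.2.19)–(8.2.20)] -/
def hfun (u : ↥(Γ : Subgroup (GL (Fin 2) ℝ)) → ℝ) (z : ℍ) : ℝ := -u (deckOf Γ z)

omit [Γ.FiniteIndex] in
/-- **Equivariance**: `hfun u (δ • z) = hfun u z + u δ`. [cite: ShimuraIATAF1971, §8.2 (8.2.19)–(8.2.20)] -/
theorem hfun_smul {u : ↥(Γ : Subgroup (GL (Fin 2) ℝ)) → ℝ} (hu : ∀ γ δ, u (γ * δ) = u γ + u δ)
    (δ : (Γ : Subgroup (GL (Fin 2) ℝ))) (z : ℍ) : hfun u (δ • z) = hfun u z + u δ := by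
  have hinv : u δ⁻¹ = -u δ := by
    have h1 : u 1 = 0 := by have := hu 1 1; rw [mul_one] at this; linarith
    have := hu δ δ⁻¹; rw [mul_inv_cancel, h1] at this; linarith
  rw [hfun, hfun, deckOf_smul_eq, hu, hinv]; ring

omit [Γ.FiniteIndex] in
/-- Equivariance for `γ ∈ Γ` given as an element of `GL₂(ℝ)`. [cite: ShimuraIATAF1971, §8.2] -/
theorem hfun_smul' {u : ↥(Γ : Subgroup (GL (Fin 2) ℝ)) → ℝ} (hu : ∀ γ δ, u (γ * δ) = u γ + u δ)
    {γ : GL (Fin 2) ℝ} (hγ : γ ∈ (Γ : Subgroup (GL (Fin 2) ℝ))) (z : ℍ) : hfun u (γ • z) = hfun u z + u ⟨γ, hγ⟩ :=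
  hfun_smul hu ⟨γ, hγ⟩ z

/-! ### Elements of `Γ` identifying points of one cusp sector are killed by `u` -/

/-- **`u` kills the elements of `Γ` moving one point of a sector `σ_i{Im > 1}` to another** (such an element fixes
the cusp, hence is `±σ_i Tⁿ σ_i⁻¹`: parabolic if `n ≠ 0`, and `1` if `n = 0` since `−1 ∉ Γ` acts trivially).
[cite: ShimuraIATAF1971, §1.3 Prop. 1.17 and §8.1 (8.1.3)] -/
theorem u_eq_zero_of_smul_frameGL_eq {u : ↥(Γ : Subgroup (GL (Fin 2) ℝ)) → ℝ} (hu : ∀ γ δ, u (γ * δ) = u γ + u δ)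
    (hpar : ∀ γ : (Γ : Subgroup (GL (Fin 2) ℝ)), (γ : GL (Fin 2) ℝ).IsParabolic → u γ = 0)
    (i : Fin (numCusps Γ)) {w w' : ℍ} (hw : 1 < w.im) (hw' : 1 < w'.im) (γ : (Γ : Subgroup (GL (Fin 2) ℝ)))
    (h : (γ : GL (Fin 2) ℝ) • frameGL Γ i • w = frameGL Γ i • w') : u γ = 0 := by
  have hΓ := pm_le_range_toGL Γ
  have hd := isDiscreteSubgroup_pm Γ
  have hγ' : (γ : GL (Fin 2) ℝ) ∈ pm Γ := le_pm Γ γ.2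
  have hfix := Literature.NumberTheory.Automorphic.Fuchsian.smul_cusp_eq_of_horoball_meet hΓ hd (frameGL_smul_infty Γ i)
    (strictPeriods_frame Γ i) hγ' le_rfl hw' hw h
  obtain ⟨n, hn⟩ := Literature.NumberTheory.Automorphic.Fuchsian.conj_eq_upperRightHom_of_smul_eq hΓ (neg_one_mem_pm Γ) hd
    (frameGL_smul_infty Γ i) (strictPeriods_frame Γ i) hγ' hfix
  by_cases hn0 : n = 0
  · -- `γ = ± 1`; it acts trivially, so `γ = 1` by freeness
    subst hn0
    have htriv : (γ : GL (Fin 2) ℝ) • w = w := by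
      have e : (γ : GL (Fin 2) ℝ) = frameGL Γ i * ((frameGL Γ i)⁻¹ * γ * frameGL Γ i) * (frameGL Γ i)⁻¹ := by group
      rcases hn with hn | hn
      · rw [e, hn]; simp only [Int.cast_zero, mul_smul, upperRightHom_smul_zero, smul_inv_smul]
      · rw [e, hn]; simp only [Int.cast_zero, mul_smul, UpperHalfPlane.neg_smul, upperRightHom_smul_zero, smul_inv_smul]
    have h1 : γ = 1 := by
      have : γ • w = (1 : (Γ : Subgroup (GL (Fin 2) ℝ))) • w := by rw [one_smul]; exact htriv
      exact IsCancelSMul.right_cancel _ _ _ this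
    rw [h1]
    have := hu 1 1; rw [mul_one] at this; linarith
  · refine hpar γ ?_
    have e : (γ : GL (Fin 2) ℝ) = frameGL Γ i * ((frameGL Γ i)⁻¹ * γ * frameGL Γ i) * (frameGL Γ i)⁻¹ := by group
    have hn0' : (n : ℝ) ≠ 0 := by exact_mod_cast hn0
    have hT : (Matrix.GeneralLinearGroup.upperRightHom (n : ℝ)).IsParabolic :=
      (Matrix.GeneralLinearGroup.isParabolic_iff_of_upperTriangular (by simp)).mpr ⟨by simp, by simpa using hn0'⟩
    rcases hn with hn | hn
    · rw [e, hn, Matrix.GeneralLinearGroup.isParabolic_conj_iff]; exact hT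
    · rw [e, hn, Matrix.GeneralLinearGroup.isParabolic_conj_iff]
      show Matrix.IsParabolic ((-Matrix.GeneralLinearGroup.upperRightHom (n : ℝ) : GL (Fin 2) ℝ) : Matrix (Fin 2) (Fin 2) ℝ)
      rw [Units.val_neg]
      exact Matrix.IsParabolic.neg hT
where
  /-- `T₀ = 1` acts trivially. [folklore] -/
  upperRightHom_smul_zero : ∀ z : ℍ, (Matrix.GeneralLinearGroup.upperRightHom (0 : ℝ) : GL (Fin 2) ℝ) • z = z := fun z => by
    rw [Literature.NumberTheory.Automorphic.Fuchsian.upperRightHom_smul]; ext; simp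

/-- `hfun u ∘ σ_i` is invariant under the identifications of the sector: `π(σ_i w) = π(σ_i w') ⇒ hfun u (σ_i w) = hfun u (σ_i w')`.
[cite: ShimuraIATAF1971, §8.1 (8.1.3)] -/
theorem hfun_frameGL_eq_of_proj_eq {u : ↥(Γ : Subgroup (GL (Fin 2) ℝ)) → ℝ} (hu : ∀ γ δ, u (γ * δ) = u γ + u δ)
    (hpar : ∀ γ : (Γ : Subgroup (GL (Fin 2) ℝ)), (γ : GL (Fin 2) ℝ).IsParabolic → u γ = 0)
    (i : Fin (numCusps Γ)) {w w' : ℍ} (hw : 1 < w.im) (hw' : 1 < w'.im)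
    (h : proj Γ (frameGL Γ i • w) = proj Γ (frameGL Γ i • w')) : hfun u (frameGL Γ i • w) = hfun u (frameGL Γ i • w') := by
  obtain ⟨γ, hγ, e⟩ := (proj_eq_iff Γ).1 h.symm
  -- `γ • σ_i w = σ_i w'`
  rw [← e, hfun_smul' hu hγ, u_eq_zero_of_smul_frameGL_eq hu hpar i hw hw' ⟨γ, hγ⟩ e, add_zero]

/-! ### `u`-primitives -/

variable (Γ) in
/-- **A `u`-primitive `G` on `W ⊆ X(Γ)`**: over `W`, `G ∘ (inl ∘ π) − hfun u` is locally constant on `ℍ`, and near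
each cusp `cuspPt i ∈ W` the function is `hfun u ∘ σ_i + G(cuspPt i)` on a horoball `σ_i{Im > T}`.
[cite: ShimuraIATAF1971, §8.1 (8.1.1)–(8.1.4) and §8.2 p. 233] -/
def IsUPrim (u : ↥(Γ : Subgroup (GL (Fin 2) ℝ)) → ℝ) (G : Cpt Γ → ℝ) (W : Set (Cpt Γ)) : Prop :=
  (∀ z : ℍ, inl Γ (proj Γ z) ∈ W → ∀ᶠ z' in 𝓝 z, G (inl Γ (proj Γ z')) - hfun u z' = G (inl Γ (proj Γ z)) - hfun u z) ∧
  (∀ i, cuspPt Γ i ∈ W → ∃ T : ℝ, 1 ≤ T ∧ ∀ w : ℍ, T < w.im → G (inl Γ (proj Γ (frameGL Γ i • w))) = hfun u (frameGL Γ i • w) + G (cuspPt Γ i))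

variable {u : ↥(Γ : Subgroup (GL (Fin 2) ℝ)) → ℝ} {G G' : Cpt Γ → ℝ} {W W' : Set (Cpt Γ)}

/-- Restriction. [cite: ShimuraIATAF1971, §8.1] -/
theorem IsUPrim.mono (h : IsUPrim Γ u G W) (hW : W' ⊆ W) : IsUPrim Γ u G W' :=
  ⟨fun z hz => h.1 z (hW hz), fun i hi => h.2 i (hW hi)⟩

/-- Adding a constant. [cite: ShimuraIATAF1971, §8.1] -/
theorem IsUPrim.add_const (h : IsUPrim Γ u G W) (c : ℝ) : IsUPrim Γ u (fun x => G x + c) W := by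
  refine ⟨fun z hz => (h.1 z hz).mono fun z' hz' => by linarith, fun i hi => ?_⟩
  obtain ⟨T, hT, hG⟩ := h.2 i hi
  exact ⟨T, hT, fun w hw => by show G _ + c = _ + (G _ + c); rw [hG w hw]; ring⟩

/-- **Two `u`-primitives on an open set differ by a locally constant function** (also at the cusps).
[cite: ShimuraIATAF1971, §8.1 (8.1.4)] -/
theorem IsUPrim.sub_eventuallyEq (h : IsUPrim Γ u G W) (h' : IsUPrim Γ u G' W) {x : Cpt Γ} (hx : x ∈ W) :
    ∀ᶠ y in 𝓝 x, G' y - G y = G' x - G x := by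
  rcases inl_or_cuspPt Γ x with ⟨y, rfl⟩ | ⟨i, rfl⟩
  · obtain ⟨z, rfl⟩ := proj_surjective Γ y
    have hz := (h.1 z hx).and (h'.1 z hx)
    -- push forward along the open map `inl ∘ π`
    obtain ⟨N, hN, hNo, hzN⟩ := mem_nhds_iff.1 hz
    have hopen : IsOpen ((inl Γ ∘ proj Γ) '' N) := ((isOpenEmbedding_inl Γ).isOpenMap.comp (isOpenMap_proj Γ)) N hNo
    filter_upwards [hopen.mem_nhds ⟨z, hzN, rfl⟩] with x hx'
    obtain ⟨z', hz', rfl⟩ := hx'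
    obtain ⟨h1, h2⟩ := hN hz'
    simp only [comp_apply]
    linarith
  · obtain ⟨T, hT, hG⟩ := h.2 i hx
    obtain ⟨T', hT', hG'⟩ := h'.2 i hx
    filter_upwards [cuspNhd_mem_nhds Γ i (le_max_of_le_left hT : (1 : ℝ) ≤ max T T')] with y hy
    rcases inl_or_cuspPt Γ y with ⟨y', rfl⟩ | ⟨j, rfl⟩
    · obtain ⟨w, hw, rfl⟩ := (inl_mem_cuspNhd_iff Γ).1 hy
      rw [hG w (lt_of_le_of_lt (le_max_left _ _) hw), hG' w (lt_of_le_of_lt (le_max_right _ _) hw)]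
      ring
    · rw [cuspPt_mem_cuspNhd_iff] at hy
      subst hy; rfl

/-! ### The primitive on a cusp disc -/

/-- **The `u`-primitive on the cusp disc** `{cuspPt i} ∪ π(σ_i{Im > 1})` with value `c` at the cusp:
`π(σ_i w) ↦ hfun u (σ_i w) + c` (well defined by `hfun_frameGL_eq_of_proj_eq`), junk `0` elsewhere.
[cite: ShimuraIATAF1971, §8.1 (8.1.3)] -/
def cuspSection (u : ↥(Γ : Subgroup (GL (Fin 2) ℝ)) → ℝ) (i : Fin (numCusps Γ)) (c : ℝ) (x : Cpt Γ) : ℝ := by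
  classical
  exact if x = cuspPt Γ i then c
    else if hx : ∃ w : ℍ, 1 < w.im ∧ inl Γ (proj Γ (frameGL Γ i • w)) = x then hfun u (frameGL Γ i • hx.choose) + c else 0

/-- Value at the cusp. [cite: ShimuraIATAF1971, §8.1] -/
@[simp] theorem cuspSection_cuspPt (u : ↥(Γ : Subgroup (GL (Fin 2) ℝ)) → ℝ) (i : Fin (numCusps Γ)) (c : ℝ) :
    cuspSection u i c (cuspPt Γ i) = c := by
  classical
  simp [cuspSection]

/-- Value on the sector. [cite: ShimuraIATAF1971, §8.1 (8.1.3)] -/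
theorem cuspSection_inl_proj (hu : ∀ γ δ, u (γ * δ) = u γ + u δ)
    (hpar : ∀ γ : (Γ : Subgroup (GL (Fin 2) ℝ)), (γ : GL (Fin 2) ℝ).IsParabolic → u γ = 0)
    (i : Fin (numCusps Γ)) (c : ℝ) {w : ℍ} (hw : 1 < w.im) :
    cuspSection u i c (inl Γ (proj Γ (frameGL Γ i • w))) = hfun u (frameGL Γ i • w) + c := by
  classical
  have hne : inl Γ (proj Γ (frameGL Γ i • w)) ≠ cuspPt Γ i := inl_ne_cuspPt Γ _ _
  have hx : ∃ w' : ℍ, 1 < w'.im ∧ inl Γ (proj Γ (frameGL Γ i • w')) = inl Γ (proj Γ (frameGL Γ i • w)) := ⟨w, hw, rfl⟩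
  rw [cuspSection, if_neg hne, dif_pos hx]
  obtain ⟨hw', he⟩ := hx.choose_spec
  rw [hfun_frameGL_eq_of_proj_eq hu hpar i hw' hw (inl_injective Γ he)]

/-- **The cusp section is a `u`-primitive on the whole cusp disc.** [cite: ShimuraIATAF1971, §8.1 (8.1.3)–(8.1.4)] -/
theorem isUPrim_cuspSection (hu : ∀ γ δ, u (γ * δ) = u γ + u δ)
    (hpar : ∀ γ : (Γ : Subgroup (GL (Fin 2) ℝ)), (γ : GL (Fin 2) ℝ).IsParabolic → u γ = 0)
    (i : Fin (numCusps Γ)) (c : ℝ) : IsUPrim Γ u (cuspSection u i c) (cuspNhd Γ i 1) := by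
  refine ⟨fun z hz => ?_, fun j hj => ?_⟩
  · obtain ⟨w, hw, hwz⟩ := (inl_mem_cuspNhd_iff Γ).1 hz
    obtain ⟨γ, hγ, e⟩ := (proj_eq_iff Γ).1 hwz
    -- near `z = γ⁻¹ σ_i w`: `z' = γ⁻¹ σ_i w'`
    have hopen : IsOpen ((γ⁻¹ * frameGL Γ i) • {w : ℍ | 1 < w.im}) := (isOpen_lt continuous_const UpperHalfPlane.continuous_im).smul _
    have hmem : z ∈ (γ⁻¹ * frameGL Γ i) • {w : ℍ | 1 < w.im} := ⟨w, hw, by show (γ⁻¹ * frameGL Γ i) • w = z; rw [mul_smul, ← e, inv_smul_smul]⟩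
    have key : ∀ z' ∈ (γ⁻¹ * frameGL Γ i) • {w : ℍ | 1 < w.im},
        cuspSection u i c (inl Γ (proj Γ z')) - hfun u z' = c - u ⟨γ⁻¹, Subgroup.inv_mem _ hγ⟩ := by
      rintro _ ⟨w', hw', rfl⟩
      show cuspSection u i c (inl Γ (proj Γ ((γ⁻¹ * frameGL Γ i) • w'))) - hfun u ((γ⁻¹ * frameGL Γ i) • w') = _
      rw [mul_smul, proj_smul Γ (Subgroup.inv_mem _ hγ), cuspSection_inl_proj hu hpar i c hw', hfun_smul' hu (Subgroup.inv_mem _ hγ)]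
      ring
    filter_upwards [hopen.mem_nhds hmem] with z' hz'
    rw [key z' hz', key z hmem]
  · rw [cuspPt_mem_cuspNhd_iff] at hj
    subst hj
    exact ⟨1, le_rfl, fun w hw => by rw [cuspSection_inl_proj hu hpar j c hw, cuspSection_cuspPt]⟩

/-! ### The local extension property -/

/-- **A slice of `π`**: every `z ∈ ℍ` has an open connected neighbourhood `V` no two distinct points of which are
`Γ`-equivalent (free proper discontinuity), so that `inl ∘ π` is injective on `V`. [cite: ShimuraIATAF1971, §1.5 Prop. 1.31] -/
theorem exists_slice (z : ℍ) : ∃ V : Set ℍ, IsOpen V ∧ z ∈ V ∧ IsPreconnected V ∧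
    ∀ γ ∈ (Γ : Subgroup (GL (Fin 2) ℝ)), ∀ z₁ ∈ V, γ • z₁ ∈ V → γ = 1 := by
  have hq : IsQuotientCoveringMap (proj Γ) (Γ : Subgroup (GL (Fin 2) ℝ)) :=
    isQuotientCoveringMap_quotientMk_of_properlyDiscontinuousSMul
  obtain ⟨U, hU, hdisj⟩ := hq.disjoint z
  -- shrink to an open ball in the chart `ℍ ⊆ ℂ`
  obtain ⟨O, hOU, hOo, hzO⟩ := mem_nhds_iff.1 hU
  haveI := ChartedSpace.locallyPathConnectedSpace ℂ ℍ
  obtain ⟨V, ⟨hVo, hzV, hVc⟩, hVO⟩ := (LocallyConnectedSpace.open_connected_basis z).mem_iff.1 (hOo.mem_nhds hzO)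
  refine ⟨V, hVo, hzV, hVc.isPreconnected, fun γ hγ z₁ hz₁ hγz₁ => ?_⟩
  have hne : ((fun x : ℍ => (⟨γ, hγ⟩ : (Γ : Subgroup (GL (Fin 2) ℝ))) • x) '' U ∩ U).Nonempty :=
    ⟨γ • z₁, ⟨z₁, hOU (hVO hz₁), rfl⟩, hOU (hVO hγz₁)⟩
  have := hdisj ⟨γ, hγ⟩ hne
  exact congrArg Subtype.val this

/-- ★ **The local extension property of `u`-primitives** (the shape consumed by the tree's monodromy theorem):
every point `x₀ ∈ X(Γ)` has an open preconnected neighbourhood `W` such that every germ at a point of `W` of a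
`u`-primitive is the germ of a `u`-primitive over `W`. [cite: ShimuraIATAF1971, §8.1 (8.1.1)–(8.1.4)] -/
theorem exists_isUPrim_extend (hu : ∀ γ δ, u (γ * δ) = u γ + u δ)
    (hpar : ∀ γ : (Γ : Subgroup (GL (Fin 2) ℝ)), (γ : GL (Fin 2) ℝ).IsParabolic → u γ = 0) (x₀ : Cpt Γ) :
    ∃ W : Set (Cpt Γ), IsOpen W ∧ x₀ ∈ W ∧ IsPreconnected W ∧
      ∀ y ∈ W, ∀ (U : Set (Cpt Γ)) (f : Cpt Γ → ℝ), IsOpen U → y ∈ U → IsUPrim Γ u f U →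
        ∃ f' : Cpt Γ → ℝ, IsUPrim Γ u f' W ∧ f =ᶠ[𝓝 y] f' := by
  classical
  rcases inl_or_cuspPt Γ x₀ with ⟨y₀, rfl⟩ | ⟨i, rfl⟩
  · -- interior point: a slice
    obtain ⟨z₀, rfl⟩ := proj_surjective Γ y₀
    obtain ⟨V, hVo, hzV, hVc, hslice⟩ := exists_slice (Γ := Γ) z₀
    set q : ℍ → Cpt Γ := inl Γ ∘ proj Γ with hq
    have hqo : IsOpenMap q := (isOpenEmbedding_inl Γ).isOpenMap.comp (isOpenMap_proj Γ)
    have hqc : Continuous q := (continuous_inl Γ).comp (continuous_proj Γ)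
    have hinj : ∀ z₁ ∈ V, ∀ z₂ ∈ V, q z₁ = q z₂ → z₁ = z₂ := by
      intro z₁ hz₁ z₂ hz₂ h
      obtain ⟨γ, hγ, e⟩ := (proj_eq_iff Γ).1 (inl_injective Γ h)
      have := hslice γ hγ z₂ hz₂ (by rw [e]; exact hz₁)
      rw [← e, this, one_smul]
    refine ⟨q '' V, hqo V hVo, ⟨z₀, hzV, rfl⟩, hVc.image q hqc.continuousOn, ?_⟩
    rintro _ ⟨z₁, hz₁, rfl⟩ U f hUo hyU hf
    -- the germ constant at `z₁`
    set c : ℝ := f (q z₁) - hfun u z₁ with hc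
    -- the extension: `hfun u ∘ (q|V)⁻¹ + c`
    let f' : Cpt Γ → ℝ := fun x => if hx : ∃ z ∈ V, q z = x then hfun u hx.choose + c else 0
    have hf' : ∀ z ∈ V, f' (q z) = hfun u z + c := by
      intro z hz
      have hx : ∃ z' ∈ V, q z' = q z := ⟨z, hz, rfl⟩
      simp only [f', dif_pos hx]
      rw [hinj _ hx.choose_spec.1 _ hz hx.choose_spec.2]
    refine ⟨f', ⟨fun z hz => ?_, fun j hj => ?_⟩, ?_⟩
    · -- interior condition at a lift `z = γ z₂`, `z₂ ∈ V`
      obtain ⟨z₂, hz₂, hqz⟩ := hz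
      obtain ⟨γ, hγ, e⟩ := (proj_eq_iff Γ).1 (inl_injective Γ hqz)
      -- near `z`, `z' = γ • z₂'` with `z₂' ∈ V`
      have hcont : ContinuousAt (fun z' : ℍ => γ • z') z := (continuous_const_smul _).continuousAt
      have hmem : γ • z ∈ V := by rw [e]; exact hz₂
      have hev : ∀ᶠ z' in 𝓝 z, γ • z' ∈ V := hcont.preimage_mem_nhds (hVo.mem_nhds hmem)
      have key : ∀ z' : ℍ, γ • z' ∈ V → f' (q z') - hfun u z' = c + u ⟨γ, hγ⟩ := by
        intro z' hz'
        have : q z' = q (γ • z') := by simp only [hq, comp_apply, proj_smul Γ hγ]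
        rw [this, hf' _ hz', hfun_smul' hu hγ]; ring
      filter_upwards [hev] with z' hz'
      change f' (q z') - hfun u z' = f' (q z) - hfun u z
      rw [key z' hz', key z hmem]
    · obtain ⟨z, -, hz⟩ := hj
      exact absurd (show inl Γ (proj Γ z) = cuspPt Γ j from hz) (inl_ne_cuspPt Γ _ _)
    · -- agreement near `q z₁`
      obtain ⟨N, hN, hNo, hzN⟩ := mem_nhds_iff.1 (hf.1 z₁ hyU)
      have hopen : IsOpen (q '' (N ∩ V)) := hqo _ (hNo.inter hVo)
      filter_upwards [hopen.mem_nhds ⟨z₁, ⟨hzN, hz₁⟩, rfl⟩] with x hx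
      obtain ⟨z', ⟨hz'N, hz'V⟩, rfl⟩ := hx
      have h1 : f (q z') - hfun u z' = f (q z₁) - hfun u z₁ := hN hz'N
      rw [hf' z' hz'V, hc]
      linarith
  · -- cusp: the cusp disc
    refine ⟨cuspNhd Γ i 1, isOpen_cuspNhd Γ i le_rfl, cuspPt_mem_cuspNhd Γ i 1, ?_, ?_⟩
    · -- the disc is the continuous image of a ball under the inverse chart
      have e : cuspNhd Γ i 1 = (cuspChart Γ i).symm '' Metric.ball 0 cuspRadius := by
        rw [← cuspChart_target Γ i, (cuspChart Γ i).symm_image_target_eq_source, cuspChart_source]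
      rw [e]
      exact (convex_ball (0 : ℂ) cuspRadius).isPreconnected.image _ (cuspChart Γ i).continuousOn_symm
    intro y hy U f hUo hyU hf
    rcases inl_or_cuspPt Γ y with ⟨y', rfl⟩ | ⟨j, rfl⟩
    · obtain ⟨w₁, hw₁, rfl⟩ := (inl_mem_cuspNhd_iff Γ).1 hy
      set c : ℝ := f (inl Γ (proj Γ (frameGL Γ i • w₁))) - hfun u (frameGL Γ i • w₁) with hc
      refine ⟨cuspSection u i c, isUPrim_cuspSection hu hpar i c, ?_⟩
      obtain ⟨N, hN, hNo, hzN⟩ := mem_nhds_iff.1 (hf.1 (frameGL Γ i • w₁) hyU)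
      have hopen : IsOpen ((inl Γ ∘ proj Γ) '' (N ∩ frameGL Γ i • {w : ℍ | 1 < w.im})) :=
        ((isOpenEmbedding_inl Γ).isOpenMap.comp (isOpenMap_proj Γ)) _ (hNo.inter (isOpen_frameGL_smul_setOf_lt Γ i 1))
      filter_upwards [hopen.mem_nhds ⟨frameGL Γ i • w₁, ⟨hzN, smul_mem_smul_set hw₁⟩, rfl⟩] with x hx
      obtain ⟨z', ⟨hz'N, ⟨w', hw', rfl⟩⟩, rfl⟩ := hx
      have h1 := hN hz'N
      simp only [mem_setOf_eq, comp_apply] at h1 ⊢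
      rw [cuspSection_inl_proj hu hpar i c hw', hc]
      linarith
    · rw [cuspPt_mem_cuspNhd_iff] at hy
      subst hy
      obtain ⟨T, hT, hfT⟩ := hf.2 j hyU
      refine ⟨cuspSection u j (f (cuspPt Γ j)), isUPrim_cuspSection hu hpar j _, ?_⟩
      filter_upwards [cuspNhd_mem_nhds Γ j hT] with x hx
      rcases inl_or_cuspPt Γ x with ⟨x', rfl⟩ | ⟨k, rfl⟩
      · obtain ⟨w, hw, rfl⟩ := (inl_mem_cuspNhd_iff Γ).1 hx
        rw [hfT w hw, cuspSection_inl_proj hu hpar j _ (lt_of_le_of_lt hT hw)]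
      · rw [cuspPt_mem_cuspNhd_iff] at hx
        subst hx
        rw [cuspSection_cuspPt]

/-- **Existence of `u`-primitives near every point.** [cite: ShimuraIATAF1971, §8.1] -/
theorem exists_isUPrim_nhds (hu : ∀ γ δ, u (γ * δ) = u γ + u δ)
    (hpar : ∀ γ : (Γ : Subgroup (GL (Fin 2) ℝ)), (γ : GL (Fin 2) ℝ).IsParabolic → u γ = 0) (x₀ : Cpt Γ) :
    ∃ W : Set (Cpt Γ), IsOpen W ∧ x₀ ∈ W ∧ IsPreconnected W ∧ ∃ G : Cpt Γ → ℝ, IsUPrim Γ u G W := by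
  classical
  rcases inl_or_cuspPt Γ x₀ with ⟨y₀, rfl⟩ | ⟨i, rfl⟩
  · -- use the extension property with the trivial germ: first build a primitive on a slice
    obtain ⟨W, hWo, hxW, hWc, hext⟩ := exists_isUPrim_extend hu hpar (inl Γ y₀)
    obtain ⟨z₀, rfl⟩ := proj_surjective Γ y₀
    -- a primitive near `inl (π z₀)`: the cusp-free slice construction is inside `hext`; feed it the germ of a
    -- primitive on a slice image, obtained from `hext` applied to ... we shortcut: any point has SOME primitive on
    -- SOME open set, namely the one produced for the slice in the proof above; re-obtain it via `hext` with the
    -- primitive on a cusp disc if `inl (π z₀)` lies in one, else via a slice. We simply redo the slice.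
    obtain ⟨V, hVo, hzV, hVc, hslice⟩ := exists_slice (Γ := Γ) z₀
    set q : ℍ → Cpt Γ := inl Γ ∘ proj Γ with hq
    have hqo : IsOpenMap q := (isOpenEmbedding_inl Γ).isOpenMap.comp (isOpenMap_proj Γ)
    have hqc : Continuous q := (continuous_inl Γ).comp (continuous_proj Γ)
    have hinj : ∀ z₁ ∈ V, ∀ z₂ ∈ V, q z₁ = q z₂ → z₁ = z₂ := by
      intro z₁ hz₁ z₂ hz₂ h
      obtain ⟨γ, hγ, e⟩ := (proj_eq_iff Γ).1 (inl_injective Γ h)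
      have := hslice γ hγ z₂ hz₂ (by rw [e]; exact hz₁)
      rw [← e, this, one_smul]
    let f' : Cpt Γ → ℝ := fun x => if hx : ∃ z ∈ V, q z = x then hfun u hx.choose else 0
    have hf' : ∀ z ∈ V, f' (q z) = hfun u z := by
      intro z hz
      have hx : ∃ z' ∈ V, q z' = q z := ⟨z, hz, rfl⟩
      simp only [f', dif_pos hx]
      rw [hinj _ hx.choose_spec.1 _ hz hx.choose_spec.2]
    refine ⟨q '' V, hqo V hVo, ⟨z₀, hzV, rfl⟩, hVc.image q hqc.continuousOn, f', fun z hz => ?_, fun j hj => ?_⟩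
    · obtain ⟨z₂, hz₂, hqz⟩ := hz
      obtain ⟨γ, hγ, e⟩ := (proj_eq_iff Γ).1 (inl_injective Γ hqz)
      have hcont : ContinuousAt (fun z' : ℍ => γ • z') z := (continuous_const_smul _).continuousAt
      have hmem : γ • z ∈ V := by rw [e]; exact hz₂
      have hev : ∀ᶠ z' in 𝓝 z, γ • z' ∈ V := hcont.preimage_mem_nhds (hVo.mem_nhds hmem)
      have key : ∀ z' : ℍ, γ • z' ∈ V → f' (q z') - hfun u z' = u ⟨γ, hγ⟩ := by
        intro z' hz'
        have : q z' = q (γ • z') := by simp only [hq, comp_apply, proj_smul Γ hγ]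
        rw [this, hf' _ hz', hfun_smul' hu hγ]; ring
      filter_upwards [hev] with z' hz'
      change f' (q z') - hfun u z' = f' (q z) - hfun u z
      rw [key z' hz', key z hmem]
    · obtain ⟨z, -, hz⟩ := hj
      exact absurd (show inl Γ (proj Γ z) = cuspPt Γ j from hz) (inl_ne_cuspPt Γ _ _)
  · exact ⟨cuspNhd Γ i 1, isOpen_cuspNhd Γ i le_rfl, cuspPt_mem_cuspNhd Γ i 1, by
      have e : cuspNhd Γ i 1 = (cuspChart Γ i).symm '' Metric.ball 0 cuspRadius := by
        rw [← cuspChart_target Γ i, (cuspChart Γ i).symm_image_target_eq_source, cuspChart_source]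
      rw [e]
      exact (convex_ball (0 : ℂ) cuspRadius).isPreconnected.image _ (cuspChart Γ i).continuousOn_symm,
      cuspSection u i 0, isUPrim_cuspSection hu hpar i 0⟩

end ModularCurve

end Literature.NumberTheory.ModularForms

end
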